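import Mathlib
import HarnessLib
import Literature.Analysis.FluidPDE.TypeIAncientMild
import Summits.NavierStokesRegularity.NavierStokesRegularity.Theorems.SqueezeCycleExtremalBiaxialitySubcriticalGaugeStrainBound

/-!
# Crux `IsobarTomography.BlobRiccatiClosure` (stmt-NavierStokesRegularity-11740), line
# `type-i-apex-liouville` — class-uniform scale-invariant derivative bounds for Type-I ancient
# mild fields (registered stub `stub_typeIGaugeBounds`)

Helper file (theorems only) `--supports` the item. For every Type-I constant `C` there are
`K₁(C), K₂(C) ≥ 0` such that every Type-I KNSS-mild ancient field `W` (`IsTypeIAncientMild C W`)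
satisfies, at every `t < 0` and every `x`,

* `(−t) ‖∇W(t)(x)‖ ≤ K₁` — the tree's `exists_gauge_norm_fderiv_le_of_typeI`;
* `(−t)^{3/2} ‖D²W(t)(x)‖ ≤ K₂` — the same argument one derivative up: KNSS 2009, Prop. 4.1 /
  (4.10) with `k = 2` on the window `[−2, −1/2)` (`exists_norm_iteratedFDeriv_le_of_typeI`)
  bounds `‖D²w(−1)(0)‖` uniformly over the class; applied to the Navier–Stokes zoom
  `w(s, y) = c W(c² s, x + c y)`, `c = √(−t)` (`isTypeIAncientMild_zoom`, the scaling (1.2)),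
  whose `k`-th derivative at `(−1, 0)` is `c^{k+1} DᵏW(t)(x)`
  (`typeIGauge_iteratedFDeriv_zoom_slice`, chain rule with the homothety `y ↦ x + c y`).

The general-order form `√(−t)^{k+1} ‖DᵏW(t)(x)‖ ≤ K(C, k)` is
`typeIGauge_exists_pow_mul_norm_iteratedFDeriv_le`.

Source: G. Koch, N. Nadirashvili, G. Seregin, V. Šverák, *Liouville theorems for the
Navier–Stokes equations and applications*, Acta Math. 203 (2009), Prop. 4.1, (4.10) and the
scaling §1 (1.2) (arXiv:0709.3599).
-/

noncomputable section

open Set Function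

-- the summit and its single sub-problem share the name (CONVENTIONS §1), as in every Theorems file
set_option linter.dupNamespace false

namespace Summit.NavierStokesRegularity.NavierStokesRegularity.Theorems.BlobRiccatiClosure.TypeIApexLiouville

open Literature.Analysis Literature.Analysis.FluidPDE
open Summit.NavierStokesRegularity.NavierStokesRegularity.Theorems

/-! ### The chain rule for the zoom at every order -/

/-- **Composing a multilinear map with a homothety in every slot**:
`M ∘ (c • id, …, c • id) = cⁿ • M`. [folklore] -/
theorem typeIGauge_compContinuousLinearMap_smul_id {E F : Type*} [NormedAddCommGroup E]
    [NormedSpace ℝ E] [NormedAddCommGroup F] [NormedSpace ℝ F] {n : ℕ}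
    (M : ContinuousMultilinearMap ℝ (fun _ : Fin n => E) F) (c : ℝ) :
    M.compContinuousLinearMap (fun _ => c • ContinuousLinearMap.id ℝ E) = (c ^ n) • M := by
  ext m
  rw [ContinuousMultilinearMap.compContinuousLinearMap_apply, smul_apply]
  have h : (fun i : Fin n => (c • ContinuousLinearMap.id ℝ E) (m i)) = fun i => c • m i := by
    funext i; simp
  rw [h, ContinuousMultilinearMap.map_smul_univ, Fin.prod_const]

/-- **Iterated derivatives of a zoomed slice**: for the Navier–Stokes zoom
`w = c • stPull c² c 0 x₀ u`, i.e. `w(s, y) = c u(c² s, x₀ + c y)`, and a `Cⁿ` slice `u (c² s)`,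
`Dⁿ w(s)(y) = c^{n+1} • Dⁿ u(c² s)(x₀ + c y)` (chain rule with the affine map `y ↦ x₀ + c y`).
[folklore] -/
theorem typeIGauge_iteratedFDeriv_zoom_slice {c : ℝ} (x₀ : EuclideanSpace ℝ (Fin 3))
    (u : ℝ → EuclideanSpace ℝ (Fin 3) → EuclideanSpace ℝ (Fin 3)) {s : ℝ} {n : ℕ}
    (hd : ContDiff ℝ n (u (c ^ 2 * s))) (y : EuclideanSpace ℝ (Fin 3)) :
    iteratedFDeriv ℝ n ((c • stPull (c ^ 2) c 0 x₀ u) s) y =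
      (c ^ (n + 1)) • iteratedFDeriv ℝ n (u (c ^ 2 * s)) (x₀ + c • y) := by
  set L : EuclideanSpace ℝ (Fin 3) →L[ℝ] EuclideanSpace ℝ (Fin 3) :=
    c • ContinuousLinearMap.id ℝ (EuclideanSpace ℝ (Fin 3)) with hL
  set g : EuclideanSpace ℝ (Fin 3) → EuclideanSpace ℝ (Fin 3) := fun z => u (c ^ 2 * s) (x₀ + z)
    with hg
  have hgc : ContDiff ℝ n g := hd.comp (contDiff_const.add contDiff_id)
  have hgL : ContDiff ℝ n (g ∘ L) := hgc.comp L.contDiff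
  have hLy : ∀ z, L z = c • z := fun z => by simp [hL]
  have hsl : (c • stPull (c ^ 2) c 0 x₀ u) s = c • (g ∘ L) := by
    rw [zoom_slice]
    funext z
    simp only [Pi.smul_apply, comp_apply, hLy, hg]
  rw [hsl, iteratedFDeriv_const_smul_apply hgL.contDiffAt, L.iteratedFDeriv_comp_right hgc y le_rfl,
    hg, iteratedFDeriv_comp_add_left, typeIGauge_compContinuousLinearMap_smul_id, smul_smul, hLy,
    ← pow_succ']

/-! ### The class-uniform bounds -/

/-- **Class-uniform scale-invariant bounds for all spatial derivatives**: for every `C` and `k`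
there is `K = K(C, k)` with `√(−t)^{k+1} ‖DᵏW(t)(x)‖ ≤ K` for every Type-I KNSS-mild ancient
field `W` with constant `C`, every `t < 0` and every `x`. KNSS 2009, Prop. 4.1 / (4.10) on the
window `[−2, −1/2)` (`exists_norm_iteratedFDeriv_le_of_typeI`) bounds `‖Dᵏw(−1)(0)‖` uniformly
over the class; it is applied to the zoom `w(s, y) = c W(c² s, x + c y)`, `c = √(−t)`
(`isTypeIAncientMild_zoom`, the scaling (1.2)), and `Dᵏw(−1)(0) = c^{k+1} DᵏW(t)(x)`
(`typeIGauge_iteratedFDeriv_zoom_slice`).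
[cite: KochNadirashviliSereginSverak2009, Prop. 4.1 (4.10) and §1 (1.2) (arXiv:0709.3599)] -/
theorem typeIGauge_exists_pow_mul_norm_iteratedFDeriv_le (C : ℝ) (k : ℕ) :
    ∃ K : ℝ, ∀ ⦃W : ℝ → EuclideanSpace ℝ (Fin 3) → EuclideanSpace ℝ (Fin 3)⦄,
      IsTypeIAncientMild C W → ∀ t < 0, ∀ x,
        Real.sqrt (-t) ^ (k + 1) * ‖iteratedFDeriv ℝ k (W t) x‖ ≤ K := by
  obtain ⟨K, hK⟩ := exists_norm_iteratedFDeriv_le_of_typeI C k (a := -3) (b := -(1 / 2))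
    (δ := 1) (by norm_num) (by norm_num) one_pos
  refine ⟨K, fun W hW t ht x => ?_⟩
  set c : ℝ := Real.sqrt (-t) with hcdef
  have hc : 0 < c := Real.sqrt_pos.2 (neg_pos.2 ht)
  have hc2 : c ^ 2 = -t := Real.sq_sqrt (neg_pos.2 ht).le
  have hts : c ^ 2 * (-1) = t := by rw [hc2]; ring
  -- the zoomed field is in the class
  have hw : IsTypeIAncientMild C (c • stPull (c ^ 2) c 0 x W) := isTypeIAncientMild_zoom hW hc x
  have hd : ContDiff ℝ k (W (c ^ 2 * (-1))) := by
    rw [hts]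
    exact (hW.contDiff_slice ht).of_le (by exact_mod_cast le_top)
  -- KNSS (4.10) at `(-1, 0)` for the zoomed field
  have h := hK hw.continuousOn_uncurry (fun s hs => hw.isWeaklyDivFree hs)
    (fun s r hsr hr y => hw.mild_eq_heatExtension hsr hr y) hw.hasTypeITimeDecay (-1)
    ⟨by norm_num, by norm_num⟩ 0
  rw [typeIGauge_iteratedFDeriv_zoom_slice x W hd 0, smul_zero, add_zero, hts, norm_smul,
    norm_pow, Real.norm_of_nonneg hc.le] at h
  exact h

/-- **Class-uniform gauge Hessian bound**: there is `K = K(C)` with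
`(−t) √(−t) ‖D²W(t)(x)‖ ≤ K` for every Type-I KNSS-mild ancient field `W` with constant `C`,
every `t < 0` and every `x` (the case `k = 2` of
`typeIGauge_exists_pow_mul_norm_iteratedFDeriv_le`, `√(−t)³ = (−t)√(−t)`).
[cite: KochNadirashviliSereginSverak2009, Prop. 4.1 (4.10) with k = 2 and §1 (1.2) (arXiv:0709.3599)] -/
theorem typeIGauge_exists_norm_iteratedFDeriv_two_le (C : ℝ) :
    ∃ K : ℝ, ∀ ⦃W : ℝ → EuclideanSpace ℝ (Fin 3) → EuclideanSpace ℝ (Fin 3)⦄,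
      IsTypeIAncientMild C W → ∀ t < 0, ∀ x,
        (-t) * Real.sqrt (-t) * ‖iteratedFDeriv ℝ 2 (W t) x‖ ≤ K := by
  obtain ⟨K, hK⟩ := typeIGauge_exists_pow_mul_norm_iteratedFDeriv_le C 2
  refine ⟨K, fun W hW t ht x => ?_⟩
  have h := hK hW t ht x
  rwa [pow_succ, Real.sq_sqrt (neg_pos.2 ht).le] at h

/-! ### The stub -/

/-- **stub_typeIGaugeBounds** (line `type-i-apex-liouville` of crux `BlobRiccatiClosure`) —
class-uniform, scale-invariant derivative bounds for Type-I ancient mild Navier–Stokes fields: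
for every `C` there are `K₁, K₂ ≥ 0` with `(−t)‖∇W(t)(x)‖ ≤ K₁` and
`(−t)^{3/2}‖D²W(t)(x)‖ ≤ K₂` for every `W` with `IsTypeIAncientMild C W`, every `t < 0`, `x`.
KNSS 2009 Prop. 4.1 / (4.10) (`k = 1, 2`) transported by the parabolic scaling (1.2):
`exists_gauge_norm_fderiv_le_of_typeI` and `typeIGauge_exists_norm_iteratedFDeriv_two_le`,
with `K₁ := max K₀ 0`, `K₂ := max K 0`.
[cite: KochNadirashviliSereginSverak2009, Prop. 4.1 (4.10) and §1 (1.2) (arXiv:0709.3599)] -/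
theorem stub_typeIGaugeBounds : ∀ C : ℝ, ∃ K₁ K₂ : ℝ, 0 ≤ K₁ ∧ 0 ≤ K₂ ∧ ∀ (W : ℝ → EuclideanSpace ℝ (Fin 3) → EuclideanSpace ℝ (Fin 3)), IsTypeIAncientMild C W → ∀ t < 0, ∀ x, (-t) * ‖fderiv ℝ (W t) x‖ ≤ K₁ ∧ (-t) * Real.sqrt (-t) * ‖iteratedFDeriv ℝ 2 (W t) x‖ ≤ K₂ := by
  intro C
  obtain ⟨K₀, hK₀⟩ := exists_gauge_norm_fderiv_le_of_typeI C
  obtain ⟨K, hK⟩ := typeIGauge_exists_norm_iteratedFDeriv_two_le C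
  refine ⟨max K₀ 0, max K 0, le_max_right _ _, le_max_right _ _, fun W hW t ht x => ⟨?_, ?_⟩⟩
  · exact (hK₀ hW t ht x).trans (le_max_left _ _)
  · exact (hK hW t ht x).trans (le_max_left _ _)

end Summit.NavierStokesRegularity.NavierStokesRegularity.Theorems.BlobRiccatiClosure.TypeIApexLiouville

end
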